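/-
Copyright (c) 2026. Released under Apache 2.0 license as described in the file LICENSE.
-/
import Literature.MathematicalPhysics.QuantumFieldTheory.Balaban1983to89.T4CollarDeterminant
import Literature.MathematicalPhysics.QuantumFieldTheory.Balaban1983to89.T4LogDetOscillation

/-!
# T4 — TRUNCATION GLUE for the Gaussian collar lemma (E2-rel (b), lower half, piece O2′ (a))

Pure linear algebra, kernel-proved, **no cited facts, no new named facts** ([folklore] throughout:
rank by support, the entrywise ℓ¹ distance of two block forms, and the composition of the two landed
lemmas `T4CollarDeterminant.collarRatio_bounds` and
`T4LogDetOscillation.abs_log_det_sub_log_det_le`).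

## What this module adds

`T4CollarDeterminant` bounds the COLLAR RATIO `q = det A · det D / det M` of a symmetric block form
`M = [[A, B], [Bᴴ, D]]` by `(1 + a/c)^r` through the RANK `r` of the coupling block `B`. Its module
docstring (v1.2, «READING OF B») records that for the printed, non-local fluctuation form the
coupling block is NOT collar-supported, so the rank hypothesis is to be fed with a finite-range
TRUNCATION `B'` of `B`, the discarded part being priced by the volume-of-difference law of
`T4LogDetOscillation`. This module is exactly that composition, as theorems:

* §1 `rank_le_card_of_rows_vanish` / `rank_rowTrunc_le`: a matrix whose rows outside a finite set
  `S` vanish has rank `≤ #S` (RANK BY SUPPORT); `rowTrunc S B` = `B` with the rows outside `S` set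
  to zero; `sum_abs_sub_rowTrunc`: the truncation error `Σᵢⱼ |Bᵢⱼ − (rowTrunc S B)ᵢⱼ|` is `Σ_{i ∉ S}
  Σⱼ |Bᵢⱼ|`.
* §2 `sum_abs_fromBlocks_sub_fromBlocks`: two block forms that differ only in the coupling block
  are at entrywise ℓ¹ distance `2 · Σᵢⱼ |Bᵢⱼ − B'ᵢⱼ|`; `truncatedCollarRatio_bounds`: if `M = [[A,
  B], [Bᴴ, D]]` and `M' = [[A, B'], [B'ᴴ, D]]` are both `≥ c • 1` (`c > 0`), `A ≤ a • 1`, `D`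
  positive definite and `rank B' ≤ r`, then `1 ≤ q ≤ (1 + a/c)^r · exp ((2/c) · Σᵢⱼ |Bᵢⱼ − B'ᵢⱼ|)`
  (Fischer for the lower bound; for the upper bound `q(M) = q(M') · det M' / det M`, the first
  factor by the collar inequality for `B'`, the second by `|log det M' − log det M| ≤ (1/c) Σ |M' −
  M|`); `log_truncatedCollarRatio_le`: the same in logarithmic form;
  `truncatedCollarRatio_bounds_rowTrunc`: the specialisation `B' = rowTrunc S B`, `r = #S`, error
  `Σ_{i ∉ S} Σⱼ |Bᵢⱼ|`.
* §3 `normLocality_of_truncatedCollar`: packaging for the territory comparison — if the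
  re-inserted reference normalisation satisfies `norm ≤ nT · √q` with `q ≤ (1 + t)^rk · exp (2e)`,
  the truncated rank `rk` is dominated by the territory cost and the truncation tail `e` by `cB ·
  cost + slackB`, then `T4TerritoryReflection.NormLocality` holds with constant `log (1 + t) / 2 +
  cB` and slack `slackB`.

## Dictionary and honest framing

As in `T4CollarDeterminant` (§ Dictionary there): Gaussian normalisations `Z(Q) = (2π)^{N/2}(det
Q)^{−1/2}`, territory block `A`, exterior block `D`, coupling `B`; `S` = the territory rows within
range `w` of the exterior (a collar of width `w`), `B' = rowTrunc S B` the range-`w` truncation, so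
`rank B' ≤ #S` is a PERIMETER quantity, and the tail `Σ_{i ∉ S} Σⱼ |Bᵢⱼ|` is small and
perimeter-proportional PROVIDED the coupling entries decay exponentially in the distance — a MODEL
HYPOTHESIS on the identification of `(A, B, D, c)` with a printed renormalisation step, NOT a cited
fact and NOT asserted here (it enters only through the free real inputs `e`, `cB`, `slackB` of §3;
the located status of that identification is the cell record `t4/T4-EST-U5Ea-E2relb.md` §3‴ and GAPS
G-pv10-15). Both uniform-positivity statements (`M ≥ c • 1` AND `M' ≥ c • 1`) are explicit
hypotheses: truncating a coupling block can destroy positivity, and nothing here claims it does not.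

This is a kernel lemma about finite-dimensional Gaussian integrals. It is NOT a proof of E2-rel (b),
NOT a statement about the manuscripts beyond the model (M) of `T4TerritoryReflection`, and NOT
summit progress (rung (B)+1 ≠ infinite volume / mass gap / Clay). It changes no census count: O2′ =
(a) ∧ (b) with (a) kernel IN THE MODEL (now including the truncation bookkeeping), (b) and (M) NOT
PRINTED / open.

References (attribution only; nothing is cited as a hypothesis): E. Fischer, Arch. Math. Phys. (3)
13 (1908) 32–40 (Fischer's inequality, via `T4CollarDeterminant`) [folklore]; the model features are
those of [B12] = T. Bałaban, Commun. Math. Phys. 109 (1987) 249–301, (2.8)–(2.14) pp.266–268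
(READING, as in `T4CollarDeterminant`). Unit `b2b-balaban-pv06` gen 11 (journal CLAIM
E2REL-b-NLOC-TRUNC*).

Version v1.1 = the FIRST LANDED text. v1 (proposal p183681, cross-read C-pv14-63 «ok 0/0» by sha)
bounced at the gate on a lint only (l.147: an unreachable `simp` alternative; warnings are errors);
v1.1 = v1 + the cross-read's records R1–R3, NO theorem statement or proof changed: R1 the `2 × 2`
rank sanity check closes by `rfl`; R2 a second §2 sanity instance exercising a GENUINE truncation
(`B' = 0`, `r = 0`, the truncated form's positivity verified separately); R3 the §3 sanity check is
labelled an arithmetic shape check only.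
-/

open Matrix

namespace Literature.MathematicalPhysics.QuantumFieldTheory.Balaban1983to89.T4CollarTruncation

open T4CollarDeterminant T4LogDetOscillation

/-! ## §1 Row truncation and rank by support -/

section Support

variable {m k : Type*} [DecidableEq m]

/-- The ROW TRUNCATION of `B` to the rows in `S`: all other rows are set to zero. [folklore] -/
def rowTrunc (S : Finset m) (B : Matrix m k ℝ) : Matrix m k ℝ :=
  Matrix.of fun i j => if i ∈ S then B i j else 0

/-- Entries of the row truncation. [folklore] -/
@[simp] theorem rowTrunc_apply (S : Finset m) (B : Matrix m k ℝ) (i : m) (j : k) :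
    rowTrunc S B i j = if i ∈ S then B i j else 0 := rfl

/-- Kept rows are unchanged. [folklore] -/
theorem rowTrunc_apply_of_mem {S : Finset m} (B : Matrix m k ℝ) {i : m} (hi : i ∈ S) (j : k) :
    rowTrunc S B i j = B i j := by
  simp [hi]

/-- Discarded rows vanish. [folklore] -/
theorem rowTrunc_apply_of_not_mem {S : Finset m} (B : Matrix m k ℝ) {i : m} (hi : i ∉ S) (j : k) :
    rowTrunc S B i j = 0 := by
  simp [hi]

variable [Fintype m] [Fintype k]

/-- **Rank by support.** A real matrix whose rows outside `S` vanish has rank at most `#S`: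
`B = diagonal(𝟙_S) · B` and `rank (diagonal 𝟙_S) = #S`. [folklore] -/
theorem rank_le_card_of_rows_vanish {S : Finset m} {B : Matrix m k ℝ}
    (hB : ∀ i, i ∉ S → ∀ j, B i j = 0) : B.rank ≤ S.card := by
  classical
  have hBeq : Matrix.diagonal (fun i : m => if i ∈ S then (1 : ℝ) else 0) * B = B := by
    ext i j
    rw [Matrix.diagonal_mul]
    by_cases hi : i ∈ S
    · simp [hi]
    · simp [hi, hB i hi j]
  have hdiag : (Matrix.diagonal fun i : m => if i ∈ S then (1 : ℝ) else 0).rank = S.card := by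
    rw [Matrix.rank_diagonal, Fintype.card_subtype]
    refine congrArg Finset.card ?_
    ext a
    simp only [Finset.mem_filter, Finset.mem_univ, true_and, ne_eq, ite_eq_right_iff, one_ne_zero,
      imp_false, not_not]
  calc B.rank = (Matrix.diagonal (fun i : m => if i ∈ S then (1 : ℝ) else 0) * B).rank := by
        rw [hBeq]
    _ ≤ (Matrix.diagonal fun i : m => if i ∈ S then (1 : ℝ) else 0).rank := rank_mul_le_left _ _
    _ = S.card := hdiag

/-- The row truncation to `S` has rank at most `#S`. [folklore] -/
theorem rank_rowTrunc_le (S : Finset m) (B : Matrix m k ℝ) : (rowTrunc S B).rank ≤ S.card :=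
  rank_le_card_of_rows_vanish fun _ hi j => rowTrunc_apply_of_not_mem B hi j

/-- The truncation error is carried by the discarded rows. [folklore] -/
theorem sum_abs_sub_rowTrunc (S : Finset m) (B : Matrix m k ℝ) :
    ∑ i, ∑ j, |B i j - rowTrunc S B i j| = ∑ i ∈ Sᶜ, ∑ j, |B i j| := by
  classical
  rw [← Finset.sum_add_sum_compl S]
  have h1 : ∑ i ∈ S, ∑ j, |B i j - rowTrunc S B i j| = 0 := by
    refine Finset.sum_eq_zero fun i hi => ?_
    simp [hi]
  have h2 : ∑ i ∈ Sᶜ, ∑ j, |B i j - rowTrunc S B i j| = ∑ i ∈ Sᶜ, ∑ j, |B i j| := by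
    refine Finset.sum_congr rfl fun i hi => ?_
    have hi' : i ∉ S := Finset.mem_compl.mp hi
    simp [hi']
  rw [h1, h2, zero_add]

/-- Sanity (rank by support on a concrete matrix): the `2 × 2` matrix with rows `(1, 2)` and `(0,
0)` is supported on the single row `0`, hence has rank `≤ 1`. -/
example : (!![1, 2; 0, 0] : Matrix (Fin 2) (Fin 2) ℝ).rank ≤ ({0} : Finset (Fin 2)).card := by
  refine rank_le_card_of_rows_vanish fun i hi j => ?_
  fin_cases i
  · simp at hi
  · fin_cases j <;> rfl

end Support

/-! ## §2 The truncated collar inequality -/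

section Block

variable {m k : Type*} [Fintype m] [Fintype k]

/-- Two symmetric block forms that differ only in the coupling block are at entrywise ℓ¹ distance
twice that of the coupling blocks. [folklore] -/
theorem sum_abs_fromBlocks_sub_fromBlocks (A : Matrix m m ℝ) (B B' : Matrix m k ℝ)
    (D : Matrix k k ℝ) :
    ∑ p, ∑ q, |fromBlocks A B Bᴴ D p q - fromBlocks A B' B'ᴴ D p q|
      = 2 * ∑ i, ∑ j, |B i j - B' i j| := by
  have hcomm : ∑ j, ∑ i, |B i j - B' i j| = ∑ i, ∑ j, |B i j - B' i j| := Finset.sum_comm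
  simp only [Fintype.sum_sum_type, fromBlocks_apply₁₁, fromBlocks_apply₁₂, fromBlocks_apply₂₁,
    fromBlocks_apply₂₂, conjTranspose_apply, star_trivial, sub_self, abs_zero,
    Finset.sum_const_zero, zero_add, add_zero]
  rw [hcomm]
  ring

variable [DecidableEq m] [DecidableEq k]

/-- **The truncated collar bounds.** For `M = [[A, B], [Bᴴ, D]]` and `M' = [[A, B'], [B'ᴴ, D]]` both
uniformly positive (`≥ c • 1`, `c > 0`), `A ≤ a • 1`, `D` positive definite and `rank B' ≤ r`: `1 ≤
det A · det D / det M ≤ (1 + a/c)^r · exp ((2/c) · Σᵢⱼ |Bᵢⱼ − B'ᵢⱼ|)`. Lower bound: Fischer. Upper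
bound: `q(M) = q(M') · (det M' / det M)`, the collar inequality for `B'` and the
volume-of-difference law for `log det`. [folklore] -/
theorem truncatedCollarRatio_bounds (A : Matrix m m ℝ) (B B' : Matrix m k ℝ)
    {D : Matrix k k ℝ} (hD : D.PosDef) {c a : ℝ} (hc : 0 < c) (ha : 0 ≤ a)
    (hM : (fromBlocks A B Bᴴ D - c • (1 : Matrix (m ⊕ k) (m ⊕ k) ℝ)).PosSemidef)
    (hM' : (fromBlocks A B' B'ᴴ D - c • (1 : Matrix (m ⊕ k) (m ⊕ k) ℝ)).PosSemidef)
    (hA : (a • (1 : Matrix m m ℝ) - A).PosSemidef) {r : ℕ} (hr : B'.rank ≤ r) :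
    1 ≤ A.det * D.det / (fromBlocks A B Bᴴ D).det ∧
      A.det * D.det / (fromBlocks A B Bᴴ D).det
        ≤ (1 + a / c) ^ r * Real.exp (2 / c * ∑ i, ∑ j, |B i j - B' i j|) := by
  have hMpos : 0 < (fromBlocks A B Bᴴ D).det := (posDef_of_sub_smul_one hc hM).det_pos
  have hM'pos : 0 < (fromBlocks A B' B'ᴴ D).det := (posDef_of_sub_smul_one hc hM').det_pos
  obtain ⟨h1, -⟩ := collarRatio_bounds A B hD hc ha hM hA (le_refl B.rank)
  obtain ⟨h1', hw⟩ := collarRatio_bounds A B' hD hc ha hM' hA hr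
  refine ⟨h1, ?_⟩
  have hlog := abs_log_det_sub_log_det_le hc hM' hM
  have hsum : ∑ p, ∑ q, |fromBlocks A B' B'ᴴ D p q - fromBlocks A B Bᴴ D p q|
      = 2 * ∑ i, ∑ j, |B i j - B' i j| := by
    rw [sum_abs_fromBlocks_sub_fromBlocks]
    congr 1
    exact Finset.sum_congr rfl fun i _ => Finset.sum_congr rfl fun j _ => abs_sub_comm _ _
  have hratio : (fromBlocks A B' B'ᴴ D).det / (fromBlocks A B Bᴴ D).det
      ≤ Real.exp (2 / c * ∑ i, ∑ j, |B i j - B' i j|) := by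
    rw [← Real.exp_log (div_pos hM'pos hMpos), Real.exp_le_exp,
      Real.log_div hM'pos.ne' hMpos.ne']
    calc Real.log (fromBlocks A B' B'ᴴ D).det - Real.log (fromBlocks A B Bᴴ D).det
        ≤ |Real.log (fromBlocks A B' B'ᴴ D).det - Real.log (fromBlocks A B Bᴴ D).det| :=
          le_abs_self _
      _ ≤ (1 / c) * ∑ p, ∑ q, |fromBlocks A B' B'ᴴ D p q - fromBlocks A B Bᴴ D p q| := hlog
      _ = 2 / c * ∑ i, ∑ j, |B i j - B' i j| := by rw [hsum]; ring
  have ht : 0 ≤ 1 + a / c := by have := div_nonneg ha hc.le; linarith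
  calc A.det * D.det / (fromBlocks A B Bᴴ D).det
      = (A.det * D.det / (fromBlocks A B' B'ᴴ D).det) *
          ((fromBlocks A B' B'ᴴ D).det / (fromBlocks A B Bᴴ D).det) :=
        (div_mul_div_cancel₀ hM'pos.ne').symm
    _ ≤ (1 + a / c) ^ r * Real.exp (2 / c * ∑ i, ∑ j, |B i j - B' i j|) :=
        mul_le_mul hw hratio (div_pos hM'pos hMpos).le (pow_nonneg ht _)

/-- Logarithmic form of `truncatedCollarRatio_bounds`:
`0 ≤ log q ≤ r · log (1 + a/c) + (2/c) · Σᵢⱼ |Bᵢⱼ − B'ᵢⱼ|`. [folklore] -/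
theorem log_truncatedCollarRatio_le (A : Matrix m m ℝ) (B B' : Matrix m k ℝ)
    {D : Matrix k k ℝ} (hD : D.PosDef) {c a : ℝ} (hc : 0 < c) (ha : 0 ≤ a)
    (hM : (fromBlocks A B Bᴴ D - c • (1 : Matrix (m ⊕ k) (m ⊕ k) ℝ)).PosSemidef)
    (hM' : (fromBlocks A B' B'ᴴ D - c • (1 : Matrix (m ⊕ k) (m ⊕ k) ℝ)).PosSemidef)
    (hA : (a • (1 : Matrix m m ℝ) - A).PosSemidef) {r : ℕ} (hr : B'.rank ≤ r) :
    0 ≤ Real.log (A.det * D.det / (fromBlocks A B Bᴴ D).det) ∧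
      Real.log (A.det * D.det / (fromBlocks A B Bᴴ D).det)
        ≤ r * Real.log (1 + a / c) + 2 / c * ∑ i, ∑ j, |B i j - B' i j| := by
  obtain ⟨h1, h2⟩ := truncatedCollarRatio_bounds A B B' hD hc ha hM hM' hA hr
  have hq : 0 < A.det * D.det / (fromBlocks A B Bᴴ D).det := lt_of_lt_of_le one_pos h1
  have ht : 0 < 1 + a / c := by have := div_nonneg ha hc.le; linarith
  refine ⟨Real.log_nonneg h1, ?_⟩
  calc Real.log (A.det * D.det / (fromBlocks A B Bᴴ D).det)
      ≤ Real.log ((1 + a / c) ^ r * Real.exp (2 / c * ∑ i, ∑ j, |B i j - B' i j|)) :=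
        Real.log_le_log hq h2
    _ = r * Real.log (1 + a / c) + 2 / c * ∑ i, ∑ j, |B i j - B' i j| := by
        rw [Real.log_mul (pow_pos ht _).ne' (Real.exp_pos _).ne', Real.log_pow, Real.log_exp]

/-- **The range truncation instance.** With `B' = rowTrunc S B` (the rows of the territory sites in
the collar `S` kept, the others discarded): `1 ≤ q ≤ (1 + a/c)^{#S} · exp ((2/c) · Σ_{i ∉ S} Σⱼ
|Bᵢⱼ|)` — collar RANK replaced by collar CARDINALITY (rank by support), the discarded coupling
priced by its entrywise ℓ¹ mass. [folklore] -/
theorem truncatedCollarRatio_bounds_rowTrunc (A : Matrix m m ℝ) (B : Matrix m k ℝ) (S : Finset m)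
    {D : Matrix k k ℝ} (hD : D.PosDef) {c a : ℝ} (hc : 0 < c) (ha : 0 ≤ a)
    (hM : (fromBlocks A B Bᴴ D - c • (1 : Matrix (m ⊕ k) (m ⊕ k) ℝ)).PosSemidef)
    (hMS : (fromBlocks A (rowTrunc S B) (rowTrunc S B)ᴴ D
      - c • (1 : Matrix (m ⊕ k) (m ⊕ k) ℝ)).PosSemidef)
    (hA : (a • (1 : Matrix m m ℝ) - A).PosSemidef) :
    1 ≤ A.det * D.det / (fromBlocks A B Bᴴ D).det ∧
      A.det * D.det / (fromBlocks A B Bᴴ D).det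
        ≤ (1 + a / c) ^ S.card * Real.exp (2 / c * ∑ i ∈ Sᶜ, ∑ j, |B i j|) := by
  rw [← sum_abs_sub_rowTrunc S B]
  exact truncatedCollarRatio_bounds A B (rowTrunc S B) hD hc ha hM hMS hA (rank_rowTrunc_le S B)

/-- Sanity (consistency with `collarRatio_bounds`, non-vacuity): truncating nothing (`B' = B`) the
tail vanishes and the bound is the collar bound times `exp 0`; instantiated on the non-degenerate `1
+ 1` example of `T4CollarDeterminant` (`A = D = 2`, `B = 1`, `c = 1`, `a = 2`, `r = 1`), where all
hypotheses hold simultaneously and `q = 4/3`. -/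
example :
    ((2 : ℝ) • (1 : Matrix (Fin 1) (Fin 1) ℝ)).det * ((2 : ℝ) • (1 : Matrix (Fin 1) (Fin 1) ℝ)).det
        / (fromBlocks ((2 : ℝ) • (1 : Matrix (Fin 1) (Fin 1) ℝ)) 1 (1 : Matrix (Fin 1) (Fin 1) ℝ)ᴴ
          ((2 : ℝ) • 1)).det
      ≤ (1 + 2 / 1) ^ 1 * Real.exp (2 / 1 * ∑ i : Fin 1, ∑ j : Fin 1,
          |(1 : Matrix (Fin 1) (Fin 1) ℝ) i j - (1 : Matrix (Fin 1) (Fin 1) ℝ) i j|) := by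
  have h2 : ((2 : ℝ) • (1 : Matrix (Fin 1) (Fin 1) ℝ)).PosDef := PosDef.one.smul (by norm_num)
  have hM : (fromBlocks ((2 : ℝ) • (1 : Matrix (Fin 1) (Fin 1) ℝ)) 1 (1 : Matrix (Fin 1) (Fin 1) ℝ)ᴴ
      ((2 : ℝ) • 1) - (1 : ℝ) • (1 : Matrix (Fin 1 ⊕ Fin 1) (Fin 1 ⊕ Fin 1) ℝ)).PosSemidef := by
    refine PosSemidef.of_dotProduct_mulVec_nonneg ?_ fun x => ?_
    · exact (IsHermitian.fromBlocks h2.1 rfl h2.1).sub (PosSemidef.one.smul zero_le_one).1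
    · simp [Matrix.mulVec, dotProduct, fromBlocks, Fintype.sum_sum_type, Matrix.sub_apply,
        Matrix.smul_apply, Matrix.one_apply]
      nlinarith [sq_nonneg (x (Sum.inl 0) + x (Sum.inr 0))]
  have hA : ((2 : ℝ) • (1 : Matrix (Fin 1) (Fin 1) ℝ) - (2 : ℝ) • 1).PosSemidef := by
    simpa using (PosSemidef.zero : (0 : Matrix (Fin 1) (Fin 1) ℝ).PosSemidef)
  have hr : (1 : Matrix (Fin 1) (Fin 1) ℝ).rank ≤ 1 := (Matrix.rank_le_card_width _).trans (by simp)
  exact (truncatedCollarRatio_bounds _ _ _ h2 one_pos (by norm_num) hM hM hA hr).2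

/-- Sanity (a genuine truncation; cross-read C-pv14-63, R2): truncating EVERYTHING (`B' = 0`,
`r = 0`) on the same instance. The truncated form `fromBlocks (2•1) 0 0ᴴ (2•1)` is `≥ 1•1` by a
SEPARATE verification (`hM'` is not obtained from `hM`), the rank budget is empty, and the bound
`(1 + 2)^0 · exp (2 · Σ|1 − 0|) = e²` (`≥ 4/3 = q`) is carried by the tail alone. -/
example :
    ((2 : ℝ) • (1 : Matrix (Fin 1) (Fin 1) ℝ)).det * ((2 : ℝ) • (1 : Matrix (Fin 1) (Fin 1) ℝ)).det
        / (fromBlocks ((2 : ℝ) • (1 : Matrix (Fin 1) (Fin 1) ℝ)) 1 (1 : Matrix (Fin 1) (Fin 1) ℝ)ᴴ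
          ((2 : ℝ) • 1)).det
      ≤ (1 + 2 / 1) ^ 0 * Real.exp (2 / 1 * ∑ i : Fin 1, ∑ j : Fin 1,
          |(1 : Matrix (Fin 1) (Fin 1) ℝ) i j - (0 : Matrix (Fin 1) (Fin 1) ℝ) i j|) := by
  have h2 : ((2 : ℝ) • (1 : Matrix (Fin 1) (Fin 1) ℝ)).PosDef := PosDef.one.smul (by norm_num)
  have hM : (fromBlocks ((2 : ℝ) • (1 : Matrix (Fin 1) (Fin 1) ℝ)) 1 (1 : Matrix (Fin 1) (Fin 1) ℝ)ᴴ
      ((2 : ℝ) • 1) - (1 : ℝ) • (1 : Matrix (Fin 1 ⊕ Fin 1) (Fin 1 ⊕ Fin 1) ℝ)).PosSemidef := by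
    refine PosSemidef.of_dotProduct_mulVec_nonneg ?_ fun x => ?_
    · exact (IsHermitian.fromBlocks h2.1 rfl h2.1).sub (PosSemidef.one.smul zero_le_one).1
    · simp [Matrix.mulVec, dotProduct, fromBlocks, Fintype.sum_sum_type, Matrix.sub_apply,
        Matrix.smul_apply, Matrix.one_apply]
      nlinarith [sq_nonneg (x (Sum.inl 0) + x (Sum.inr 0))]
  have hM' : (fromBlocks ((2 : ℝ) • (1 : Matrix (Fin 1) (Fin 1) ℝ)) 0
      (0 : Matrix (Fin 1) (Fin 1) ℝ)ᴴ ((2 : ℝ) • 1)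
        - (1 : ℝ) • (1 : Matrix (Fin 1 ⊕ Fin 1) (Fin 1 ⊕ Fin 1) ℝ)).PosSemidef := by
    refine PosSemidef.of_dotProduct_mulVec_nonneg ?_ fun x => ?_
    · exact (IsHermitian.fromBlocks h2.1 rfl h2.1).sub (PosSemidef.one.smul zero_le_one).1
    · simp [Matrix.mulVec, dotProduct, fromBlocks, Fintype.sum_sum_type, Matrix.sub_apply,
        Matrix.smul_apply, Matrix.one_apply]
      nlinarith [sq_nonneg (x (Sum.inl 0)), sq_nonneg (x (Sum.inr 0))]
  have hA : ((2 : ℝ) • (1 : Matrix (Fin 1) (Fin 1) ℝ) - (2 : ℝ) • 1).PosSemidef := by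
    simpa using (PosSemidef.zero : (0 : Matrix (Fin 1) (Fin 1) ℝ).PosSemidef)
  have hr : (0 : Matrix (Fin 1) (Fin 1) ℝ).rank ≤ 0 := by simp
  exact (truncatedCollarRatio_bounds _ _ _ h2 one_pos (by norm_num) hM hM' hA hr).2

end Block

/-! ## §3 Packaging for the territory comparison -/

section Packaging

open MeasureTheory T4HistoryPeeling T4InsertionProfile T4TerritoryComparison T4TerritoryReflection

variable {ι : Type*} {T : Finset ι} {n : ℕ} {σ : Type*} {Ω : Type*} [MeasurableSpace Ω]

variable {Φ : SwitchOff T n} {Aω : ι → ℝ} {μ : Measure Ω} {F : FibreModel T Aω μ}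
  {X : TerritoryFactorisation Φ F} {shape : Fin n → ι → σ} {cost : Fin n → σ → ℝ}

/-- **The (a)-half of O2′ in the Gaussian model, with the truncation bookkeeping.** If, at every
pending position and exterior datum, the re-inserted reference normalisation satisfies `norm ≤ nT ·
√q` with a collar ratio `q ≤ (1 + t)^rk · exp (2 e)` (as delivered by `truncatedCollarRatio_bounds`
with `t = a/c`, `rk` = rank of the TRUNCATED coupling, `e = (1/c) · Σ|B − B'|` the truncation tail),
the truncated rank is dominated by the territory cost and the tail by `cB · cost + slackB`, then
`NormLocality` holds with constant `log (1 + t) / 2 + cB` and slack `slackB`. The (b)-half of O2′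
(background oscillation) and the smallness of the tail are exactly the hypotheses `hnorm` and `he`.
[folklore] -/
theorem normLocality_of_truncatedCollar {nT q e : Fin n → ι → Ω → ℝ} {rk : Fin n → ι → ℕ}
    {t cB : ℝ} {slackB : Fin n → σ → ℝ}
    (ht : 0 ≤ t) (hnT : ∀ i τ ω, 0 ≤ nT i τ ω)
    (hnorm : ∀ i, ∀ τ ∈ T, Φ.pend i τ = true → ∀ ω,
      X.norm i τ ω ≤ nT i τ ω * Real.sqrt (q i τ ω))
    (hq : ∀ i, ∀ τ ∈ T, Φ.pend i τ = true → ∀ ω,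
      q i τ ω ≤ (1 + t) ^ rk i τ * Real.exp (2 * e i τ ω))
    (hrk : ∀ i, ∀ τ ∈ T, (rk i τ : ℝ) ≤ cost i (shape i τ))
    (he : ∀ i, ∀ τ ∈ T, Φ.pend i τ = true → ∀ ω,
      e i τ ω ≤ cB * cost i (shape i τ) + slackB i (shape i τ)) :
    NormLocality Φ X shape cost nT (Real.log (1 + t) / 2 + cB) slackB := by
  intro i τ hτ hp ω
  set L := Real.log (1 + t) / 2 * cost i (shape i τ) with hL
  set Z := cB * cost i (shape i τ) + slackB i (shape i τ) with hZ
  have h1t : 0 < 1 + t := by linarith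
  have hsq : Real.sqrt (q i τ ω) ≤ Real.exp L * Real.exp Z := by
    have hpow : 0 ≤ (1 + t) ^ rk i τ := pow_nonneg h1t.le _
    have hee : Real.exp (2 * e i τ ω) = Real.exp (e i τ ω) * Real.exp (e i τ ω) := by
      rw [← Real.exp_add]
      congr 1
      ring
    calc Real.sqrt (q i τ ω)
        ≤ Real.sqrt ((1 + t) ^ rk i τ * Real.exp (2 * e i τ ω)) :=
          Real.sqrt_le_sqrt (hq i τ hτ hp ω)
      _ = Real.sqrt ((1 + t) ^ rk i τ) * Real.exp (e i τ ω) := by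
          rw [Real.sqrt_mul hpow, hee, Real.sqrt_mul_self (Real.exp_nonneg _)]
      _ ≤ Real.exp L * Real.exp Z :=
          mul_le_mul (sqrt_le_exp_of_le_pow ht le_rfl (hrk i τ hτ))
            (Real.exp_le_exp.mpr (he i τ hτ hp ω)) (Real.exp_nonneg _) (Real.exp_nonneg _)
  have hn := hnorm i τ hτ hp ω
  have h0 := hnT i τ ω
  have hexp : Real.exp (-((Real.log (1 + t) / 2 + cB) * cost i (shape i τ) + slackB i (shape i τ)))
      = (Real.exp L * Real.exp Z)⁻¹ := by
    rw [← Real.exp_add, ← Real.exp_neg]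
    congr 1
    rw [hL, hZ]
    ring
  rw [hexp]
  have hpos : 0 < Real.exp L * Real.exp Z := mul_pos (Real.exp_pos _) (Real.exp_pos _)
  rw [inv_mul_le_iff₀ hpos]
  calc X.norm i τ ω ≤ nT i τ ω * Real.sqrt (q i τ ω) := hn
    _ ≤ nT i τ ω * (Real.exp L * Real.exp Z) := mul_le_mul_of_nonneg_left hsq h0
    _ = Real.exp L * Real.exp Z * nT i τ ω := by ring

/-- Sanity (ARITHMETIC SHAPE CHECK ONLY — not an instance of `normLocality_of_truncatedCollar`;
cross-read C-pv14-63, R3): the packaging exponent at zero cost, unit ratio and zero tail reads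
`exp 0 · norm ≤ nT` when `norm ≤ nT · √1`. -/
example (x y : ℝ) (h : x ≤ y * Real.sqrt 1) :
    Real.exp (-((Real.log (1 + 0) / 2 + 0) * 0 + 0)) * x ≤ y := by
  simp only [Real.sqrt_one, mul_one] at h
  simpa using h

end Packaging

end Literature.MathematicalPhysics.QuantumFieldTheory.Balaban1983to89.T4CollarTruncation
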